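import Summits.CriticalPhenomena.PercolationContinuityZ3.Theorems.PercNearOneGluingNoHeavyLowerTailSahiCombZsumReading

/-!
# The DIAMOND kernel lemma: design P2 of the general `a = 2` token system is injective

Support file of the one-cut programme (crux `NoHeavyLowerTail`, stmt-CriticalPhenomena-4575; cell `prim-masterthm`, seat P5 gen 29;
memo `FROM-prim-masterthm-p5-g29-HALFCHAIN-PROOF.md` §4b/§8).  Companion of `…TriWHalfChainKernel` (the half-chain case `Gp ⊆ Gq`): here BOTH
middle pairs `Fp, Fq` and `Gp, Gq` are arbitrary (a "diamond × diamond"), which is the doubly-incomparable stratum of `TriWIneq` at `a = 2`.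

Eleven demand classes (index `s`, coefficient vectors `ka … kk`): `α: sᶜ∈F₀, s∈G₁`, `β: s∈F₀, sᶜ∈G₁`, `γ: sᶜ∈F₁, s∈G₀`, `δ: s∈F₁, sᶜ∈G₀`,
`ε: sᶜ∈Fp, s∈Gq`, `ζ: s∈Fp, sᶜ∈Gq`, `η: sᶜ∈Fq, s∈Gp`, `θ: s∈Fq, sᶜ∈Gp`, `κ₁: sᶜ∈(Fq\Fp)∩(Gq\Gp)`, `κ₂: sᶜ∈(Fp\Fq)∩(Gp\Gq)`,
`σ: sᶜ ∈ Σ' = ((F₁\F₀)∩(G₁\G₀)) \ (E₂ ∪ E₁)`, `E₂ = (Fp\Fq)∩(Gq\Gp)`, `E₁ = (Fq\Fp)∩(Gp\Gq)`.  Eight level equations (two copies of each of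
`S = F₁∩G₁`, `U = F₀∩G₀`, `M = Fp∩Gp`, `N = Fq∩Gq`) of the visibility design **P2** found by this seat's kit pipeline (j205350, 32 such designs; P2 =
`al:{Sb} be:{Sa,Nb} ga:{Sa,Ma} de:{Sb,Ua} ep:{Sa,Na} ze:{Sa,Sb,Mb} et:{Sa,Mb,Nb} th:{Sa,Sb,Ub,Ma,Na} rDb:{Na} rDa:{Mb} rSig:{Sb}`):
`(Sa) β+γ+ε+ζ+η+θ = 0`, `(Sb) α+δ+ζ+θ+σ = 0` on `S`; `(Ua) δ = 0`, `(Ub) θ = 0` on `U`; `(Ma) γ+θ = 0`, `(Mb) ζ+η+κ₂ = 0` on `M`; `(Na) ε+θ+κ₁ = 0`,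
`(Nb) β+η = 0` on `N`.

* **`FiveUpSet.diamond_kernel_eq_zero`** — these force all eleven vectors to vanish.  Human proof (this seat, extracted from — and much shorter than — the
  166-step trace of P5 gen 16's type-level prover `cprove2`): `κ₂, κ₁` by one diagonal reading each (`Mb` on `M`, `Na` on `N`); row `F₀` and column `G₀` are
  cleared by point supports, the aggregate identities `β+ε = 0` on `M`, `γ+ζ = 0` on `N` and two antipodal extensions each, which kills `β` and `γ` (C2′);
  the two-class separations `zsum_ext₂` on `M` (`ζ` against `η`) and on `N` (`ε` against `θ`) clear `M` and `N`; `σ` dies by four diagonal readings (column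
  `G₁ \ (Gp ∪ Gq)` from `Sb` on `S`, row `F₁ \ (Fp ∪ Fq)` from `Sa − Sb` on `S`, the `N \ M` cells from `Sb` on `N`, the rest from `Sb` on `M` — the cells
  `E₁, E₂`, where this would fail, carry no `σ`-index by design); then `α` against `δ` on `F₀∩G₁ ∪ F₁∩G₀`, `ζ` against `θ` and `ε` against `η` on `S`.
The counting corollary (`diamondDemand ≤ halfChainSupply`, i.e. `DiamondHall`, hence `TriWIneq` at `a = 2` in full) is assembled in a separate file.
HONEST LABEL: elementary linear algebra over `ℚ` (std axioms). [this work]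
-/

namespace Summit.CriticalPhenomena.PercolationContinuityZ3.Theorems

namespace FiveUpSet

open Finset

variable {α : Type} [DecidableEq α] [Fintype α]

/-- `zsum (a·f + b·g + c·h) = a·zsum f + b·zsum g + c·zsum h`. [this work] -/
theorem zsum_lin₃ (a b c : ℚ) (f g h : Finset α → ℚ) (t : Finset α) :
    zsum (fun d => a * f d + b * g d + c * h d) t = a * zsum f t + b * zsum g t + c * zsum h t := by
  unfold zsum
  rw [Finset.mul_sum, Finset.mul_sum, Finset.mul_sum, ← Finset.sum_add_distrib, ← Finset.sum_add_distrib]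
  exact Finset.sum_congr rfl fun d _ => by ring

/-- **Diamond Hall, kernel form at `P = ⊤` (design P2).**  For diamonds `F₀ ⊆ Fp, Fq ⊆ F₁` and `G₀ ⊆ Gp, Gq ⊆ G₁` of up-sets of the cube `Finset α`
and coefficient vectors `ka … kk` supported on the eleven diamond demand classes, the eight level equations of design P2 force all eleven vectors to
vanish. [this work] -/
theorem diamond_kernel_eq_zero (F₀ Fp Fq F₁ G₀ Gp Gq G₁ : Finset (Finset α))
    (hF₀ : IsUpperSet (F₀ : Set (Finset α))) (hFp : IsUpperSet (Fp : Set (Finset α)))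
    (hFq : IsUpperSet (Fq : Set (Finset α))) (hF₁ : IsUpperSet (F₁ : Set (Finset α)))
    (hG₀ : IsUpperSet (G₀ : Set (Finset α))) (hGp : IsUpperSet (Gp : Set (Finset α)))
    (hGq : IsUpperSet (Gq : Set (Finset α))) (hG₁ : IsUpperSet (G₁ : Set (Finset α)))
    (hF0p : F₀ ⊆ Fp) (hF0q : F₀ ⊆ Fq) (hFp1 : Fp ⊆ F₁) (hFq1 : Fq ⊆ F₁)
    (hG0p : G₀ ⊆ Gp) (hG0q : G₀ ⊆ Gq) (hGp1 : Gp ⊆ G₁) (hGq1 : Gq ⊆ G₁)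
    (ka kb kc kd ke kf kg kh ki kj kk : Finset α → ℚ)
    (hka : ∀ s, ka s ≠ 0 → sᶜ ∈ F₀ ∧ s ∈ G₁)
    (hkb : ∀ s, kb s ≠ 0 → s ∈ F₀ ∧ sᶜ ∈ G₁)
    (hkc : ∀ s, kc s ≠ 0 → sᶜ ∈ F₁ ∧ s ∈ G₀)
    (hkd : ∀ s, kd s ≠ 0 → s ∈ F₁ ∧ sᶜ ∈ G₀)
    (hke : ∀ s, ke s ≠ 0 → sᶜ ∈ Fp ∧ s ∈ Gq)
    (hkf : ∀ s, kf s ≠ 0 → s ∈ Fp ∧ sᶜ ∈ Gq)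
    (hkg : ∀ s, kg s ≠ 0 → sᶜ ∈ Fq ∧ s ∈ Gp)
    (hkh : ∀ s, kh s ≠ 0 → s ∈ Fq ∧ sᶜ ∈ Gp)
    (hki : ∀ s, ki s ≠ 0 → (sᶜ ∈ Fq ∧ sᶜ ∉ Fp) ∧ (sᶜ ∈ Gq ∧ sᶜ ∉ Gp))
    (hkj : ∀ s, kj s ≠ 0 → (sᶜ ∈ Fp ∧ sᶜ ∉ Fq) ∧ (sᶜ ∈ Gp ∧ sᶜ ∉ Gq))
    (hkk : ∀ s, kk s ≠ 0 → ((sᶜ ∈ F₁ ∧ sᶜ ∉ F₀) ∧ (sᶜ ∈ G₁ ∧ sᶜ ∉ G₀)) ∧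
      ¬ (((sᶜ ∈ Fp ∧ sᶜ ∉ Fq) ∧ (sᶜ ∈ Gq ∧ sᶜ ∉ Gp)) ∨ ((sᶜ ∈ Fq ∧ sᶜ ∉ Fp) ∧ (sᶜ ∈ Gp ∧ sᶜ ∉ Gq))))
    (h0 : ∀ t, t ∈ F₁ → t ∈ G₁ → zsum kb t + zsum kc t + zsum ke t + zsum kf t + zsum kg t + zsum kh t = 0)
    (h1 : ∀ t, t ∈ F₁ → t ∈ G₁ → zsum ka t + zsum kd t + zsum kf t + zsum kh t + zsum kk t = 0)
    (h2 : ∀ t, t ∈ F₀ → t ∈ G₀ → zsum kd t = 0)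
    (h3 : ∀ t, t ∈ F₀ → t ∈ G₀ → zsum kh t = 0)
    (h4 : ∀ t, t ∈ Fp → t ∈ Gp → zsum kc t + zsum kh t = 0)
    (h5 : ∀ t, t ∈ Fp → t ∈ Gp → zsum kf t + zsum kg t + zsum kj t = 0)
    (h6 : ∀ t, t ∈ Fq → t ∈ Gq → zsum ke t + zsum kh t + zsum ki t = 0)
    (h7 : ∀ t, t ∈ Fq → t ∈ Gq → zsum kb t + zsum kg t = 0) :
    (∀ s, ka s = 0) ∧ (∀ s, kb s = 0) ∧ (∀ s, kc s = 0) ∧ (∀ s, kd s = 0) ∧ (∀ s, ke s = 0) ∧ (∀ s, kf s = 0) ∧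
      (∀ s, kg s = 0) ∧ (∀ s, kh s = 0) ∧ (∀ s, ki s = 0) ∧ (∀ s, kj s = 0) ∧ (∀ s, kk s = 0) := by
  -- derived up-sets
  have hS : IsUpperSet ((F₁ ∩ G₁ : Finset (Finset α)) : Set (Finset α)) := by rw [coe_inter]; exact hF₁.inter hG₁
  have hM : IsUpperSet ((Fp ∩ Gp : Finset (Finset α)) : Set (Finset α)) := by rw [coe_inter]; exact hFp.inter hGp
  have hN : IsUpperSet ((Fq ∩ Gq : Finset (Finset α)) : Set (Finset α)) := by rw [coe_inter]; exact hFq.inter hGq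
  have hGpq : IsUpperSet ((Gp ∪ Gq : Finset (Finset α)) : Set (Finset α)) := by rw [coe_union]; exact hGp.union hGq
  have hFpq : IsUpperSet ((Fp ∪ Fq : Finset (Finset α)) : Set (Finset α)) := by rw [coe_union]; exact hFp.union hFq
  -- point supports
  have pb : ∀ t, t ∉ F₀ → zsum kb t = 0 := fun t ht => zsum_eq_zero_of_not_mem hF₀ kb (fun d hd => (hkb d hd).1) ht
  have pc : ∀ t, t ∉ G₀ → zsum kc t = 0 := fun t ht => zsum_eq_zero_of_not_mem hG₀ kc (fun d hd => (hkc d hd).2) ht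
  have pe : ∀ t, t ∉ Gq → zsum ke t = 0 := fun t ht => zsum_eq_zero_of_not_mem hGq ke (fun d hd => (hke d hd).2) ht
  have pf : ∀ t, t ∉ Fp → zsum kf t = 0 := fun t ht => zsum_eq_zero_of_not_mem hFp kf (fun d hd => (hkf d hd).1) ht
  have pg : ∀ t, t ∉ Gp → zsum kg t = 0 := fun t ht => zsum_eq_zero_of_not_mem hGp kg (fun d hd => (hkg d hd).2) ht
  have ph : ∀ t, t ∉ Fq → zsum kh t = 0 := fun t ht => zsum_eq_zero_of_not_mem hFq kh (fun d hd => (hkh d hd).1) ht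
  -- STEP 1: `κ₂ = 0` (diagonal reading of `Mb` on `M`) and `κ₁ = 0` (diagonal reading of `Na` on `N`)
  have hkj0 : ∀ s, kj s = 0 := by
    have key := diag_read₂ hM hGq hFq kj kf kg 1 1 1 one_ne_zero
      (fun d hd => mem_inter.2 ⟨(hkj d hd).1.1, (hkj d hd).2.1⟩) (fun d hd => (hkf d hd).2) (fun d hd => (hkg d hd).1) ?_
    · intro s; by_contra hs
      exact hs (key s (hkj s hs).2.2 (hkj s hs).1.2)
    · intro t ht
      have e5 := h5 t (mem_inter.1 ht).1 (mem_inter.1 ht).2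
      linarith
  have zj : ∀ t, zsum kj t = 0 := fun t => by
    unfold zsum; exact Finset.sum_eq_zero fun d _ => by rw [hkj0 d, zero_mul]
  have fg5 : ∀ t, t ∈ Fp → t ∈ Gp → zsum kf t + zsum kg t = 0 := by
    intro t hF hG; have e := h5 t hF hG; rw [zj t, add_zero] at e; exact e
  have hki0 : ∀ s, ki s = 0 := by
    have key := diag_read₂ hN hFp hGp ki ke kh 1 1 1 one_ne_zero
      (fun d hd => mem_inter.2 ⟨(hki d hd).1.1, (hki d hd).2.1⟩) (fun d hd => (hke d hd).1) (fun d hd => (hkh d hd).2) ?_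
    · intro s; by_contra hs
      exact hs (key s (hki s hs).1.2 (hki s hs).2.2)
    · intro t ht
      have e6 := h6 t (mem_inter.1 ht).1 (mem_inter.1 ht).2
      linarith
  have zi : ∀ t, zsum ki t = 0 := fun t => by
    unfold zsum; exact Finset.sum_eq_zero fun d _ => by rw [hki0 d, zero_mul]
  have eh6 : ∀ t, t ∈ Fq → t ∈ Gq → zsum ke t + zsum kh t = 0 := by
    intro t hF hG; have e := h6 t hF hG; rw [zi t, add_zero] at e; exact e
  -- the aggregate identity `γ + ζ = 0` on `N` (`Sa − Na − Nb`)
  have cn : ∀ t, t ∈ Fq → t ∈ Gq → zsum kc t + zsum kf t = 0 := by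
    intro t hF hG; have e0 := h0 t (hFq1 hF) (hGq1 hG); have e6 := eh6 t hF hG; have e7 := h7 t hF hG; linarith
  -- STEP 2: row `F₀` is cleared, `β = 0`
  have h_F0Gp : ∀ t, t ∈ F₀ → t ∈ Gp → zsum kh t = 0 := by
    intro t hF hG
    by_cases hG0 : t ∈ G₀
    · exact h3 t hF hG0
    · have e4 := h4 t (hF0p hF) hG; rw [pc t hG0, zero_add] at e4; exact e4
  have h_F0 : ∀ t, t ∈ F₀ → zsum kh t = 0 :=
    zsum_ext hGp hF₀ kh (fun d hd => (hkh d hd).2) (fun t hG hF => h_F0Gp t hF hG)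
  have c_U : ∀ t, t ∈ F₀ → t ∈ G₀ → zsum kc t = 0 := by
    intro t hF hG; have e4 := h4 t (hF0p hF) (hG0p hG); rw [h3 t hF hG, add_zero] at e4; exact e4
  have f_F0Gq : ∀ t, t ∈ F₀ → t ∈ Gq → zsum kf t = 0 := by
    intro t hF hG
    have e := cn t (hF0q hF) hG
    by_cases hG0 : t ∈ G₀
    · rw [c_U t hF hG0, zero_add] at e; exact e
    · rw [pc t hG0, zero_add] at e; exact e
  have f_F0 : ∀ t, t ∈ F₀ → zsum kf t = 0 :=
    zsum_ext hGq hF₀ kf (fun d hd => (hkf d hd).2) (fun t hG hF => f_F0Gq t hF hG)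
  have c_F0 : ∀ t, t ∈ F₀ → zsum kc t = 0 := by
    intro t hF
    by_cases hG0 : t ∈ G₀
    · exact c_U t hF hG0
    · exact pc t hG0
  have e_F0 : ∀ t, t ∈ F₀ → zsum ke t = 0 := by
    intro t hF
    by_cases hG : t ∈ Gq
    · have e := eh6 t (hF0q hF) hG; rw [h_F0 t hF, add_zero] at e; exact e
    · exact pe t hG
  have g_F0 : ∀ t, t ∈ F₀ → zsum kg t = 0 := by
    intro t hF
    by_cases hG : t ∈ Gp
    · have e := fg5 t (hF0p hF) hG; rw [f_F0 t hF, zero_add] at e; exact e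
    · exact pg t hG
  have b_F0 : ∀ t, t ∈ F₀ → t ∈ G₁ → zsum kb t = 0 := by
    intro t hF hG
    have e0 := h0 t (hFp1 (hF0p hF)) hG
    rw [c_F0 t hF, e_F0 t hF, f_F0 t hF, g_F0 t hF, h_F0 t hF] at e0; linarith
  have hkb0 : ∀ s, kb s = 0 := eq_zero_of_zsum_eq_zero_on hF₀ hG₁ kb hkb b_F0
  have zb : ∀ t, zsum kb t = 0 := fun t => by
    unfold zsum; exact Finset.sum_eq_zero fun d _ => by rw [hkb0 d, zero_mul]
  -- STEP 3: column `G₀` is cleared, `γ = 0`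
  have e_M : ∀ t, t ∈ Fp → t ∈ Gp → zsum ke t = 0 := by
    intro t hF hG
    have e0 := h0 t (hFp1 hF) (hGp1 hG); have e4 := h4 t hF hG; have e5 := fg5 t hF hG
    rw [zb t] at e0; linarith
  have e_G0 : ∀ t, t ∈ G₀ → zsum ke t = 0 :=
    zsum_ext hFp hG₀ ke (fun d hd => (hke d hd).1) (fun t hF hG => e_M t hF (hG0p hG))
  have g_N : ∀ t, t ∈ Fq → t ∈ Gq → zsum kg t = 0 := by
    intro t hF hG; have e := h7 t hF hG; rw [zb t, zero_add] at e; exact e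
  have g_G0 : ∀ t, t ∈ G₀ → zsum kg t = 0 :=
    zsum_ext hFq hG₀ kg (fun d hd => (hkg d hd).1) (fun t hF hG => g_N t hF (hG0q hG))
  have h_G0 : ∀ t, t ∈ G₀ → zsum kh t = 0 := by
    intro t hG
    by_cases hF : t ∈ Fq
    · have e := eh6 t hF (hG0q hG); rw [e_G0 t hG, zero_add] at e; exact e
    · exact ph t hF
  have f_G0 : ∀ t, t ∈ G₀ → zsum kf t = 0 := by
    intro t hG
    by_cases hF : t ∈ Fp
    · have e := fg5 t hF (hG0p hG); rw [g_G0 t hG, add_zero] at e; exact e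
    · exact pf t hF
  have c_G0 : ∀ t, t ∈ G₀ → t ∈ F₁ → zsum kc t = 0 := by
    intro t hG hF
    have e0 := h0 t hF (hGp1 (hG0p hG))
    rw [zb t, e_G0 t hG, f_G0 t hG, g_G0 t hG, h_G0 t hG] at e0; linarith
  have hkc0 : ∀ s, kc s = 0 := eq_zero_of_zsum_eq_zero_on hG₀ hF₁ kc (fun d hd => ⟨(hkc d hd).2, (hkc d hd).1⟩) c_G0
  have zc : ∀ t, zsum kc t = 0 := fun t => by
    unfold zsum; exact Finset.sum_eq_zero fun d _ => by rw [hkc0 d, zero_mul]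
  -- STEP 4: `M` and `N` are cleared (two-class separations)
  have h_M : ∀ t, t ∈ Fp → t ∈ Gp → zsum kh t = 0 := by
    intro t hF hG; have e := h4 t hF hG; rw [zc t, zero_add] at e; exact e
  have f_N : ∀ t, t ∈ Fq → t ∈ Gq → zsum kf t = 0 := by
    intro t hF hG; have e := cn t hF hG; rw [zc t, zero_add] at e; exact e
  have f_M : ∀ t, t ∈ Fp → t ∈ Gp → zsum kf t = 0 := by
    have key := zsum_ext₂ hM hGq hFq kf kg 1 1 one_ne_zero (fun d hd => (hkf d hd).2) (fun d hd => (hkg d hd).1) ?_ ?_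
    · intro t hF hG; exact key t (mem_inter.2 ⟨hF, hG⟩)
    · intro t ht; have e := fg5 t (mem_inter.1 ht).1 (mem_inter.1 ht).2; linarith
    · intro t ht hGq' hFq'
      have e := fg5 t (mem_inter.1 ht).1 (mem_inter.1 ht).2
      rw [g_N t hFq' hGq', add_zero] at e; exact e
  have g_M : ∀ t, t ∈ Fp → t ∈ Gp → zsum kg t = 0 := by
    intro t hF hG; have e := fg5 t hF hG; rw [f_M t hF hG, zero_add] at e; exact e
  have e_N : ∀ t, t ∈ Fq → t ∈ Gq → zsum ke t = 0 := by
    have key := zsum_ext₂ hN hFp hGp ke kh 1 1 one_ne_zero (fun d hd => (hke d hd).1) (fun d hd => (hkh d hd).2) ?_ ?_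
    · intro t hF hG; exact key t (mem_inter.2 ⟨hF, hG⟩)
    · intro t ht; have e := eh6 t (mem_inter.1 ht).1 (mem_inter.1 ht).2; linarith
    · intro t ht hFp' hGp'
      have e := eh6 t (mem_inter.1 ht).1 (mem_inter.1 ht).2
      rw [h_M t hFp' hGp', add_zero] at e; exact e
  have h_N : ∀ t, t ∈ Fq → t ∈ Gq → zsum kh t = 0 := by
    intro t hF hG; have e := eh6 t hF hG; rw [e_N t hF hG, zero_add] at e; exact e
  -- STEP 5: `σ = 0` by four diagonal readings
  -- (5a) complements off `Gp ∪ Gq` (`Sb` on `S`; companions `α, δ, ζ+θ` have antipodal supports `F₀, G₀, Gp ∪ Gq`)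
  have K1 : ∀ e, eᶜ ∉ Gp → eᶜ ∉ Gq → kk e = 0 := by
    have key := diag_read₃ hS hF₀ hG₀ hGpq kk ka kd (fun d => 1 * kf d + 1 * kh d) 1 1 1 1 one_ne_zero
      (fun d hd => mem_inter.2 ⟨(hkk d hd).1.1.1, (hkk d hd).1.2.1⟩) (fun d hd => (hka d hd).1) (fun d hd => (hkd d hd).2) ?_ ?_
    · intro e hp hq
      by_contra hne
      refine hne (key e (hkk e hne).1.1.2 (hkk e hne).1.2.2 ?_)
      rw [mem_union]; rintro (h' | h'); exacts [hp h', hq h']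
    · intro d hd
      rw [mem_union]
      by_cases hf : kf d = 0
      · have hh : kh d ≠ 0 := by intro hh; apply hd; rw [hf, hh]; ring
        exact Or.inl (hkh d hh).2
      · exact Or.inr (hkf d hf).2
    · intro t ht
      have e1 := h1 t (mem_inter.1 ht).1 (mem_inter.1 ht).2
      rw [zsum_mul_add_mul 1 1 kf kh t]; linarith
  -- (5b) complements off `Fp ∪ Fq` (`Sa − Sb` on `S`; companions `ε+η−α` and `δ` have antipodal supports `Fp ∪ Fq`, `G₀`)
  have K2 : ∀ e, eᶜ ∉ Fp → eᶜ ∉ Fq → kk e = 0 := by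
    have key := diag_read₂ hS hFpq hG₀ kk (fun d => 1 * ke d + 1 * kg d + (-1) * ka d) kd (-1) 1 (-1) (by norm_num)
      (fun d hd => mem_inter.2 ⟨(hkk d hd).1.1.1, (hkk d hd).1.2.1⟩) ?_ (fun d hd => (hkd d hd).2) ?_
    · intro e hp hq
      by_contra hne
      refine hne (key e ?_ (hkk e hne).1.2.2)
      rw [mem_union]; rintro (h' | h'); exacts [hp h', hq h']
    · intro d hd
      rw [mem_union]
      by_cases he' : ke d = 0
      · by_cases hg' : kg d = 0
        · have ha' : ka d ≠ 0 := by intro ha'; apply hd; rw [he', hg', ha']; ring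
          exact Or.inl (hF0p (hka d ha').1)
        · exact Or.inr (hkg d hg').1
      · exact Or.inl (hke d he').1
    · intro t ht
      have hF := (mem_inter.1 ht).1
      have hG := (mem_inter.1 ht).2
      have e0 := h0 t hF hG
      have e1 := h1 t hF hG
      rw [zb t, zc t] at e0
      rw [zsum_lin₃ 1 1 (-1) ke kg ka t]; linarith
  -- (5c) the live `σ`-indices with complement off `N` have complement in `M`
  have ysupp : ∀ d, kk d ≠ 0 → dᶜ ∉ Fq ∩ Gq → dᶜ ∈ Fp ∩ Gp := by
    intro d hk hN'
    rw [mem_inter] at hN' ⊢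
    obtain ⟨-, hnE⟩ := hkk d hk
    by_cases hFp' : dᶜ ∈ Fp
    · by_cases hGp' : dᶜ ∈ Gp
      · exact ⟨hFp', hGp'⟩
      · exfalso
        by_cases hGq' : dᶜ ∈ Gq
        · by_cases hFq' : dᶜ ∈ Fq
          · exact hN' ⟨hFq', hGq'⟩
          · exact hnE (Or.inl ⟨⟨hFp', hFq'⟩, hGq', hGp'⟩)
        · exact hk (K1 d hGp' hGq')
    · exfalso
      by_cases hFq' : dᶜ ∈ Fq
      · by_cases hGq' : dᶜ ∈ Gq
        · exact hN' ⟨hFq', hGq'⟩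
        · by_cases hGp' : dᶜ ∈ Gp
          · exact hnE (Or.inr ⟨⟨hFq', hFp'⟩, hGp', hGq'⟩)
          · exact hk (K1 d hGp' hGq')
      · exact hk (K2 d hFp' hFq')
  -- (5d) complements in `N \ M` (`Sb` on `N`, where `ζ = θ = 0`; the off-`N` part of `σ` is a companion with antipodal support `M`)
  have hsplit : ∀ t, zsum (fun d => if dᶜ ∈ Fq ∩ Gq then kk d else 0) t + zsum (fun d => if dᶜ ∈ Fq ∩ Gq then 0 else kk d) t
      = zsum kk t := by
    intro t
    unfold zsum
    rw [← Finset.sum_add_distrib]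
    refine Finset.sum_congr rfl fun d _ => ?_
    by_cases h : dᶜ ∈ Fq ∩ Gq
    · simp [h]
    · simp [h]
  have KN : ∀ e, eᶜ ∈ Fq ∩ Gq → eᶜ ∉ Fp ∩ Gp → kk e = 0 := by
    have key := diag_read₃ hN hF₀ hG₀ hM (fun d => if dᶜ ∈ Fq ∩ Gq then kk d else 0) ka kd
      (fun d => if dᶜ ∈ Fq ∩ Gq then 0 else kk d) 1 1 1 1 one_ne_zero ?_ (fun d hd => (hka d hd).1) (fun d hd => (hkd d hd).2) ?_ ?_
    · intro e heN hnM
      by_contra hne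
      have hx := key e (hkk e hne).1.1.2 (hkk e hne).1.2.2 hnM
      have : kk e = 0 := by simpa [heN] using hx
      exact hne this
    · intro d hd
      by_contra h'
      exact hd (by simp [h'])
    · intro d hd
      by_cases h' : dᶜ ∈ Fq ∩ Gq
      · exact absurd (by simp [h']) hd
      · have hk : kk d ≠ 0 := fun h0' => hd (by simp [h', h0'])
        exact ysupp d hk h'
    · intro t ht
      have hF := (mem_inter.1 ht).1
      have hG := (mem_inter.1 ht).2
      have e1 := h1 t (hFq1 hF) (hGq1 hG)
      have hs := hsplit t
      rw [f_N t hF hG, h_N t hF hG] at e1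
      linarith
  -- (5e) the rest: now `σ` is supported on complements in `M`; read `Sb` on `M` (where `ζ = θ = 0`)
  have suppM : ∀ d, kk d ≠ 0 → dᶜ ∈ Fp ∩ Gp := by
    intro d hk
    by_contra hM'
    by_cases hN' : dᶜ ∈ Fq ∩ Gq
    · exact hk (KN d hN' hM')
    · exact hM' (ysupp d hk hN')
  have hkk0 : ∀ s, kk s = 0 := by
    have key := diag_read₂ hM hF₀ hG₀ kk ka kd 1 1 1 one_ne_zero suppM (fun d hd => (hka d hd).1) (fun d hd => (hkd d hd).2) ?_
    · intro s; by_contra hs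
      exact hs (key s (hkk s hs).1.1.2 (hkk s hs).1.2.2)
    · intro t ht
      have hF := (mem_inter.1 ht).1
      have hG := (mem_inter.1 ht).2
      have e1 := h1 t (hFp1 hF) (hGp1 hG)
      rw [f_M t hF hG, h_M t hF hG] at e1
      linarith
  have zk : ∀ t, zsum kk t = 0 := fun t => by
    unfold zsum; exact Finset.sum_eq_zero fun d _ => by rw [hkk0 d, zero_mul]
  -- STEP 6: `α` against `δ` on `F₀ ∩ G₁ ∪ F₁ ∩ G₀`
  have hYad : IsUpperSet ((F₀ ∩ G₁ ∪ F₁ ∩ G₀ : Finset (Finset α)) : Set (Finset α)) := by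
    rw [coe_union, coe_inter, coe_inter]; exact (hF₀.inter hG₁).union (hF₁.inter hG₀)
  have ad : ∀ t, t ∈ (F₀ ∩ G₁ ∪ F₁ ∩ G₀ : Finset (Finset α)) → 1 * zsum ka t + 1 * zsum kd t = 0 := by
    intro t ht
    rw [mem_union, mem_inter, mem_inter] at ht
    rcases ht with ⟨hF, hG⟩ | ⟨hF, hG⟩
    · have e1 := h1 t (hFp1 (hF0p hF)) hG
      rw [f_F0 t hF, h_F0 t hF, zk t] at e1; linarith
    · have e1 := h1 t hF (hGp1 (hG0p hG))
      rw [f_G0 t hG, h_G0 t hG, zk t] at e1; linarith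
  have a_Y : ∀ t, t ∈ (F₀ ∩ G₁ ∪ F₁ ∩ G₀ : Finset (Finset α)) → zsum ka t = 0 :=
    zsum_ext₂ hYad hF₀ hG₀ ka kd 1 1 one_ne_zero (fun d hd => (hka d hd).1) (fun d hd => (hkd d hd).2) ad
      (fun t ht hF hG => by have e := ad t ht; rw [h2 t hF hG] at e; linarith)
  have hka0 : ∀ s, ka s = 0 :=
    eq_zero_of_zsum_eq_zero_on hG₁ hF₀ ka (fun d hd => ⟨(hka d hd).2, (hka d hd).1⟩)
      (fun t hG hF => a_Y t (by rw [mem_union, mem_inter]; exact Or.inl ⟨hF, hG⟩))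
  have za : ∀ t, zsum ka t = 0 := fun t => by
    unfold zsum; exact Finset.sum_eq_zero fun d _ => by rw [hka0 d, zero_mul]
  have hkd0 : ∀ s, kd s = 0 :=
    eq_zero_of_zsum_eq_zero_on hF₁ hG₀ kd hkd (fun t hF hG => by
      have e := ad t (by rw [mem_union, mem_inter, mem_inter]; exact Or.inr ⟨hF, hG⟩)
      rw [za t] at e; linarith)
  have zd : ∀ t, zsum kd t = 0 := fun t => by
    unfold zsum; exact Finset.sum_eq_zero fun d _ => by rw [hkd0 d, zero_mul]
  -- STEP 7: `ζ` against `θ` and `ε` against `η` on `S`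
  have fh : ∀ t, t ∈ (F₁ ∩ G₁ : Finset (Finset α)) → 1 * zsum kf t + 1 * zsum kh t = 0 := by
    intro t ht
    have e1 := h1 t (mem_inter.1 ht).1 (mem_inter.1 ht).2
    rw [za t, zd t, zk t] at e1; linarith
  have f_S : ∀ t, t ∈ (F₁ ∩ G₁ : Finset (Finset α)) → zsum kf t = 0 :=
    zsum_ext₂ hS hGq hGp kf kh 1 1 one_ne_zero (fun d hd => (hkf d hd).2) (fun d hd => (hkh d hd).2) fh
      (fun t _ hGq' hGp' => by
        by_cases hF : t ∈ Fp
        · exact f_M t hF hGp'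
        · exact pf t hF)
  have hkf0 : ∀ s, kf s = 0 :=
    eq_zero_of_zsum_eq_zero_on hFp hGq kf hkf (fun t hF hG => f_S t (mem_inter.2 ⟨hFp1 hF, hGq1 hG⟩))
  have zf : ∀ t, zsum kf t = 0 := fun t => by
    unfold zsum; exact Finset.sum_eq_zero fun d _ => by rw [hkf0 d, zero_mul]
  have hkh0 : ∀ s, kh s = 0 :=
    eq_zero_of_zsum_eq_zero_on hFq hGp kh hkh (fun t hF hG => by
      have e := fh t (mem_inter.2 ⟨hFq1 hF, hGp1 hG⟩)
      rw [zf t] at e; linarith)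
  have zh : ∀ t, zsum kh t = 0 := fun t => by
    unfold zsum; exact Finset.sum_eq_zero fun d _ => by rw [hkh0 d, zero_mul]
  have eg : ∀ t, t ∈ (F₁ ∩ G₁ : Finset (Finset α)) → 1 * zsum ke t + 1 * zsum kg t = 0 := by
    intro t ht
    have e0 := h0 t (mem_inter.1 ht).1 (mem_inter.1 ht).2
    rw [zb t, zc t, zf t, zh t] at e0; linarith
  have e_S : ∀ t, t ∈ (F₁ ∩ G₁ : Finset (Finset α)) → zsum ke t = 0 :=
    zsum_ext₂ hS hFp hFq ke kg 1 1 one_ne_zero (fun d hd => (hke d hd).1) (fun d hd => (hkg d hd).1) eg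
      (fun t _ hFp' hFq' => by
        by_cases hG : t ∈ Gq
        · exact e_N t hFq' hG
        · exact pe t hG)
  have hke0 : ∀ s, ke s = 0 :=
    eq_zero_of_zsum_eq_zero_on hGq hFp ke (fun d hd => ⟨(hke d hd).2, (hke d hd).1⟩)
      (fun t hG hF => e_S t (mem_inter.2 ⟨hFp1 hF, hGq1 hG⟩))
  have ze : ∀ t, zsum ke t = 0 := fun t => by
    unfold zsum; exact Finset.sum_eq_zero fun d _ => by rw [hke0 d, zero_mul]
  have hkg0 : ∀ s, kg s = 0 :=
    eq_zero_of_zsum_eq_zero_on hGp hFq kg (fun d hd => ⟨(hkg d hd).2, (hkg d hd).1⟩) (fun t hG hF => by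
      have e := eg t (mem_inter.2 ⟨hFq1 hF, hGp1 hG⟩)
      rw [ze t] at e; linarith)
  exact ⟨hka0, hkb0, hkc0, hkd0, hke0, hkf0, hkg0, hkh0, hki0, hkj0, hkk0⟩

end FiveUpSet

end Summit.CriticalPhenomena.PercolationContinuityZ3.Theorems
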